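import Summits.AtomisticToContinuum.BoseEinsteinCondensation.Theorems.BECCutLineWeakDisorderFlatModeFromLandscape
import Literature.MathematicalPhysics.QuantumManyBody.LiebYngvasonBoxBound
import HarnessLib

/-!
# Crux `LandscapeBound` (stmt-AtomisticToContinuum-9087): the constant is at least `1`, and the universal-constant strengthening is false

Negative / tightness lemmas of the standing disprover of crux `LandscapeBound` (route
`BECCutLineWeakDisorder`, rank 2), landed copy of § Tightness of
`Cruxes/LandscapeBound/Disproof.lean`. The crux asks, for every admissible `v` and small `ρ`, for a
constant `C > 0` such that for all large `N = n + 1` and every `δ > 0` some nonnegative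
`δ`-near-minimiser `Ψ ∈ TrialState (n+1) L`, `L = (N/ρ)^{1/3}`, has landscape functional
`∫ L³ m(Y)²/s(Y)² dY ≤ C` (`m(Y) = ∫ |Ψ(x,Y)|² dx`, `s(Y) = ∫ |Ψ(x,Y)| dx`).

* `one_le_landscapeRatio` — for EVERY admissible trial state (any sign, any energy) the functional
  is `≥ 1`: Cauchy–Schwarz on each box slice (`s² ≤ L³ m`, `lintegral_slice_sq_le`), the pointwise
  bound `m ≤ L³ m²/s²` (`sliceMass_le_landscapeIntegrand`; `s = 0 ⇒ m = 0`, `s < ∞`) and Tonelli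
  `∫ m dY = ‖Ψ‖² = 1`.
* `one_le_const_of_landscape` — hence any constant `C` for which the inner clause of the crux holds
  at some `(v, ρ)` satisfies `1 ≤ C`.
* `not_landscapeBoundAnyConst` — the strengthening of the crux with a UNIVERSAL constant
  (`∀ C > 0` in place of `∃ C > 0`, stated inline) is FALSE (witness `v = 0`, `C = 1/2`);
  `not_landscapeBoundConst_of_lt_one` — no prescribed constant `C < 1` works.

So a proof of the crux must produce `C ≥ 1` (for `v = 0` the sharp value along near-minimisers is
`(π²/8)³ ≈ 1.878`, recorded as a near-miss in the work file). No Theses statement is asserted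
positively; no `def`. All `[folklore]`.
-/

noncomputable section

open MeasureTheory Set Filter
open scoped ENNReal NNReal

namespace Summit.AtomisticToContinuum.BoseEinsteinCondensation.Theorems.LandscapeBound.Negative

open Literature.MathematicalPhysics.QuantumManyBody.BoseGas
open Summit.AtomisticToContinuum.BoseEinsteinCondensation.Theses.BECCutLineWeakDisorder
open Summit.AtomisticToContinuum.BoseEinsteinCondensation.Theorems.FlatModeFromLandscape

variable {n : ℕ} {L : ℝ}

/-! ## Tightness: the landscape functional is at least `1` on every trial state -/

/-- `ofReal (L³) = (ofReal L)³` for every real `L` (both sides vanish for `L ≤ 0`). [folklore] -/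
theorem ofReal_pow_three (L : ℝ) : ENNReal.ofReal (L ^ 3) = ENNReal.ofReal L ^ 3 := by
  rcases le_or_gt 0 L with hL | hL
  · exact ENNReal.ofReal_pow hL 3
  · have h3 : L ^ 3 ≤ 0 := by nlinarith [sq_nonneg L]
    rw [ENNReal.ofReal_of_nonpos hL.le, ENNReal.ofReal_of_nonpos h3]
    norm_num

/-- **Cauchy–Schwarz on a box slice.** For an admissible trial state and every bath
configuration `Y`, `s(Y)² ≤ L³ · m(Y)`: the slice `x ↦ Ψ(x, Y)` vanishes off the box `Λ_L` of
volume `L³`. [folklore] -/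
theorem lintegral_slice_sq_le (Ψ : TrialState (n + 1) L) (Y : Config n) :
    (∫⁻ x, (‖Ψ.ψ (Matrix.vecCons x Y)‖₊ : ℝ≥0∞)) ^ 2 ≤
      ENNReal.ofReal (L ^ 3) * ∫⁻ x, (‖Ψ.ψ (Matrix.vecCons x Y)‖₊ : ℝ≥0∞) ^ 2 := by
  have hΨm : Measurable Ψ.ψ := Ψ.contDiff.continuous.measurable
  have hg : Measurable fun x : Space => (‖Ψ.ψ (Matrix.vecCons x Y)‖₊ : ℝ≥0∞) :=
    (measurable_comp_vecCons_left hΨm Y).nnnorm.coe_nnreal_ennreal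
  set f : Space → ℝ≥0∞ := (box L).indicator 1 with hf
  have hfm : Measurable f := measurable_one.indicator (measurableSet_box L)
  have hfg : ∀ x, f x * (‖Ψ.ψ (Matrix.vecCons x Y)‖₊ : ℝ≥0∞) =
      (‖Ψ.ψ (Matrix.vecCons x Y)‖₊ : ℝ≥0∞) := by
    intro x
    by_cases hx : x ∈ box L
    · simp [f, hx]
    · simp [f, hx, slice_eq_zero Ψ Y hx]
  have hf2 : ∫⁻ x, f x ^ 2 = ENNReal.ofReal (L ^ 3) := by
    have : (fun x => f x ^ 2) = (box L).indicator 1 := by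
      funext x; by_cases hx : x ∈ box L <;> simp [f, hx]
    rw [this, lintegral_indicator_one (measurableSet_box L), volume_box, ofReal_pow_three]
  calc (∫⁻ x, (‖Ψ.ψ (Matrix.vecCons x Y)‖₊ : ℝ≥0∞)) ^ 2
      = (∫⁻ x, f x * (‖Ψ.ψ (Matrix.vecCons x Y)‖₊ : ℝ≥0∞)) ^ 2 := by simp_rw [hfg]
    _ ≤ (∫⁻ x, f x ^ 2) * ∫⁻ x, (‖Ψ.ψ (Matrix.vecCons x Y)‖₊ : ℝ≥0∞) ^ 2 :=
        lintegral_mul_sq_le volume hfm.aemeasurable hg.aemeasurable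
    _ = _ := by rw [hf2]

/-- **Pointwise tightness of the landscape integrand**: `m(Y) ≤ L³ m(Y)² / s(Y)²` for every `Y`
(from `s² ≤ L³ m`; where `s(Y) = 0` also `m(Y) = 0`; `s(Y) < ∞` since the slice is continuous with
compact support). [folklore] -/
theorem sliceMass_le_landscapeIntegrand (Ψ : TrialState (n + 1) L) (Y : Config n) :
    ∫⁻ x, (‖Ψ.ψ (Matrix.vecCons x Y)‖₊ : ℝ≥0∞) ^ 2 ≤
      ENNReal.ofReal (L ^ 3) * (∫⁻ x, (‖Ψ.ψ (Matrix.vecCons x Y)‖₊ : ℝ≥0∞) ^ 2) ^ 2 /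
        (∫⁻ x, (‖Ψ.ψ (Matrix.vecCons x Y)‖₊ : ℝ≥0∞)) ^ 2 := by
  have hΨm : Measurable Ψ.ψ := Ψ.contDiff.continuous.measurable
  have hslice : Measurable fun x : Space => (‖Ψ.ψ (Matrix.vecCons x Y)‖₊ : ℝ≥0∞) :=
    (measurable_comp_vecCons_left hΨm Y).nnnorm.coe_nnreal_ennreal
  set m := ∫⁻ x, (‖Ψ.ψ (Matrix.vecCons x Y)‖₊ : ℝ≥0∞) ^ 2 with hm
  set s := ∫⁻ x, (‖Ψ.ψ (Matrix.vecCons x Y)‖₊ : ℝ≥0∞) with hs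
  by_cases h0 : s = 0
  · have hm0 : m = 0 := by
      have h1 := (lintegral_eq_zero_iff hslice).1 h0
      refine (lintegral_eq_zero_iff (hslice.pow_const 2)).2 ?_
      filter_upwards [h1] with x hx
      simp only [Pi.zero_apply] at hx ⊢
      simp [hx]
    rw [hm0]
    exact bot_le
  have hsfin : s ≠ ⊤ := (hasFiniteIntegral_iff_enorm.mp (integrable_slice Ψ Y).2).ne
  rw [ENNReal.le_div_iff_mul_le (Or.inl (pow_ne_zero 2 h0)) (Or.inl (ENNReal.pow_ne_top hsfin))]
  calc m * s ^ 2 ≤ m * (ENNReal.ofReal (L ^ 3) * m) := by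
        gcongr
        exact lintegral_slice_sq_le Ψ Y
    _ = ENNReal.ofReal (L ^ 3) * m ^ 2 := by ring

/-- **Tightness of the crux's constant: the landscape functional is `≥ 1` on EVERY admissible
trial state** (nonnegative or not, near-minimising or not): `1 = ∫ m ≤ ∫ L³ m²/s²` (Tonelli in
`x :: Y`, normalisation, pointwise tightness). Hence no `C < 1` can ever be witnessed.
[folklore] -/
theorem one_le_landscapeRatio (Ψ : TrialState (n + 1) L) :
    1 ≤ ∫⁻ Y : Config n, ENNReal.ofReal (L ^ 3) *
      (∫⁻ x, (‖Ψ.ψ (Matrix.vecCons x Y)‖₊ : ℝ≥0∞) ^ 2) ^ 2 /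
        (∫⁻ x, (‖Ψ.ψ (Matrix.vecCons x Y)‖₊ : ℝ≥0∞)) ^ 2 := by
  have hΨm : Measurable Ψ.ψ := Ψ.contDiff.continuous.measurable
  calc (1 : ℝ≥0∞) = ∫⁻ Y : Config n, ∫⁻ x, (‖Ψ.ψ (Matrix.vecCons x Y)‖₊ : ℝ≥0∞) ^ 2 := by
        rw [lintegral_lintegral_sq_nnnorm_vecCons hΨm, Ψ.norm_eq]
    _ ≤ _ := lintegral_mono fun Y => sliceMass_le_landscapeIntegrand Ψ Y

/-- **The constant of `LandscapeBound` is at least `1`**: if the inner clause of the crux holds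
at `(v, ρ)` with constant `C` (for eventually all `n` and every `δ > 0` a witness with landscape
functional `≤ C`), then `1 ≤ C` — whatever `v` and `ρ` are. [folklore] -/
theorem one_le_const_of_landscape {v : ℝ → ℝ≥0∞} {ρ C : ℝ}
    (h : ∀ᶠ n : ℕ in atTop, ∀ δ : ℝ≥0∞, 0 < δ →
      ∃ Ψ : TrialState (n + 1) (sideLength ρ (n + 1)),
        energy v Ψ ≤ groundStateEnergy v (n + 1) (sideLength ρ (n + 1)) + δ ∧
        (∀ X, Ψ.ψ X = (‖Ψ.ψ X‖ : ℂ)) ∧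
        ∫⁻ Y : Config n, ENNReal.ofReal (sideLength ρ (n + 1) ^ 3) *
            (∫⁻ x, (‖Ψ.ψ (Matrix.vecCons x Y)‖₊ : ℝ≥0∞) ^ 2) ^ 2 /
              (∫⁻ x, (‖Ψ.ψ (Matrix.vecCons x Y)‖₊ : ℝ≥0∞)) ^ 2 ≤ ENNReal.ofReal C) :
    1 ≤ C := by
  obtain ⟨n, hn⟩ := h.exists
  obtain ⟨Ψ, -, -, hΨ⟩ := hn 1 one_pos
  exact ENNReal.one_le_ofReal.1 ((one_le_landscapeRatio Ψ).trans hΨ)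

/-! ## A refuted natural strengthening: a universal constant -/

/-- **The universal-constant strengthening of the crux is false** (`∀ C > 0` in place of
`∃ C > 0`; what "`E_Q[R] → 1 + o(1)` uniformly" would say if read with `C` arbitrary): at the free gas `v = 0` (admissible) and `C = 1/2`
no trial state whatsoever has landscape functional `≤ 1/2 < 1`. The crux's `∃ C` cannot be
upgraded to `∀ C`, and any proof must produce a constant `≥ 1`. [folklore] -/
theorem not_landscapeBoundAnyConst :
    ¬ ∀ v : ℝ → ℝ≥0∞, IsRepulsiveFiniteRange v → ∃ ρ₀ : ℝ, 0 < ρ₀ ∧ ∀ ρ : ℝ, 0 < ρ → ρ < ρ₀ →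
      ∀ C : ℝ, 0 < C → ∀ᶠ n : ℕ in atTop, ∀ δ : ℝ≥0∞, 0 < δ →
        ∃ Ψ : TrialState (n + 1) (sideLength ρ (n + 1)),
          energy v Ψ ≤ groundStateEnergy v (n + 1) (sideLength ρ (n + 1)) + δ ∧
          (∀ X, Ψ.ψ X = (‖Ψ.ψ X‖ : ℂ)) ∧
          ∫⁻ Y : Config n, ENNReal.ofReal (sideLength ρ (n + 1) ^ 3) *
              (∫⁻ x, (‖Ψ.ψ (Matrix.vecCons x Y)‖₊ : ℝ≥0∞) ^ 2) ^ 2 /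
                (∫⁻ x, (‖Ψ.ψ (Matrix.vecCons x Y)‖₊ : ℝ≥0∞)) ^ 2 ≤ ENNReal.ofReal C := by
  intro h
  obtain ⟨ρ₀, hρ₀, H⟩ := h 0 ⟨measurable_const, ⟨0, fun _ _ => rfl⟩⟩
  have := one_le_const_of_landscape
    (H (ρ₀ / 2) (by positivity) (by linarith) (1 / 2) (by norm_num))
  norm_num at this

/-- **No prescribed constant `C < 1` works** (the crux with the same `C` for all `v, ρ`; witness
`v = 0`). [folklore] -/
theorem not_landscapeBoundConst_of_lt_one {C : ℝ} (hC : C < 1) :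
    ¬ ∀ v : ℝ → ℝ≥0∞, IsRepulsiveFiniteRange v → ∃ ρ₀ : ℝ, 0 < ρ₀ ∧ ∀ ρ : ℝ, 0 < ρ → ρ < ρ₀ →
      ∀ᶠ n : ℕ in atTop, ∀ δ : ℝ≥0∞, 0 < δ →
        ∃ Ψ : TrialState (n + 1) (sideLength ρ (n + 1)),
          energy v Ψ ≤ groundStateEnergy v (n + 1) (sideLength ρ (n + 1)) + δ ∧
          (∀ X, Ψ.ψ X = (‖Ψ.ψ X‖ : ℂ)) ∧
          ∫⁻ Y : Config n, ENNReal.ofReal (sideLength ρ (n + 1) ^ 3) *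
              (∫⁻ x, (‖Ψ.ψ (Matrix.vecCons x Y)‖₊ : ℝ≥0∞) ^ 2) ^ 2 /
                (∫⁻ x, (‖Ψ.ψ (Matrix.vecCons x Y)‖₊ : ℝ≥0∞)) ^ 2 ≤ ENNReal.ofReal C := by
  intro h
  obtain ⟨ρ₀, hρ₀, H⟩ := h 0 ⟨measurable_const, ⟨0, fun _ _ => rfl⟩⟩
  have := one_le_const_of_landscape (H (ρ₀ / 2) (by positivity) (by linarith))
  linarith

end Summit.AtomisticToContinuum.BoseEinsteinCondensation.Theorems.LandscapeBound.Negative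

end
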